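import Summits.BirchSwinnertonDyer.BirchSwinnertonDyer.Theorems.ByReductionTypeAtTwoOrdEisensteinHalfShaDictionary
import Summits.BirchSwinnertonDyer.BirchSwinnertonDyer.Theorems.ByReductionTypeAtTwoKatoHalfPinch
import Summits.BirchSwinnertonDyer.Rank1Residual.X5.KatoOrdTwoMuPart
import Summits.BirchSwinnertonDyer.Rank1Residual.X5.KatoOrdTwoTowerGapIff
import Summits.BirchSwinnertonDyer.Rank1Residual.X5.TwoAdicTargetsAlpha
import HarnessLib

/-!
# The Eisenstein half of the `2`-adic main conjecture in `Ш`-currency, III: the Eisenstein clause, the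
# main conjecture and `BSD(E,2)` at a rank-`0` good-ordinary curve are ONE descent inequality beyond the
# Kato half (route ByReductionTypeAtTwo / TwoAdicConverse, crux `OrdEisensteinHalfAtTwo`,
# item stmt-BirchSwinnertonDyer-19272; seat bsd-2adic-ord-3, GEN 2)

HONEST FRAMING (cell `bsd-2adic`, HUMAN RULINGS D-0036/D-0074): THEOREMS ONLY — no definition, no named
fact, nothing asserted, closes nothing; PUBLISHED inputs are displayed hypotheses (`h17` Kato 17.4 (1)(2)
AT `2`, `hEC` Greenberg 4.1 AT `2`, `hGZK`, `hmod`); `MissingLowerBoundAt W 2` (`ord₂ #Ш_an ≤ ord₂ #Ш`,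
Miller's currency) is a per-curve DESCENT statement that this file does not discharge for any curve.

WHAT IS PROVED (all at analytic rank `0`, `E` good ordinary at `2`, any residual image, CM or not).
* §3 (datum level) (B) `eisensteinAtDatum_iff_sha_slack` / `eisensteinAtDatum_iff_sha`: the crux's
  clause `∃ h ∈ Λ, ι f_X = ι h·ϖ·L₂(f,α)` at a cyclotomic datum with `ι L₀ = 2ʲ·ϖ·L₂` holds IFF
  `μ(L₀) ≤ μ(X) + j` AND `ord₂ #Ш_an + j + μ(X) ≤ ord₂ #Ш + μ(L₀)` — NO `λ` anywhere; (C)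
  `charIdeal_eq_span_iff_mu_le_and_missingLowerBoundAt`: `char_Λ X = (L₀)` (Néron-integral `L₀`) IFF
  `μ(X) ≤ μ(L₀)` AND `MissingLowerBoundAt W 2`; (B′)/(C′): under a `μ`-match `μ(X) = μ(L₀)` both the
  Eisenstein clause and the main conjecture at the datum ARE `MissingLowerBoundAt W 2`.
* §4 (curve level) `mazurMainConjecture_two_of_katoHalf_of_missingLowerBoundAt`: Kato half
  (`X5.O1.MainConjectureLowerDivisibilityAtTwoOrd W`, crux `OrdKatoHalfAtTwo` at `W`) + `MissingLowerBoundAt W 2`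
  ⇒ `MazurMainConjecture W 2`, hence the Eisenstein half (`eisensteinAtTwo_of_katoHalf_of_missingLowerBoundAt`)
  and `BSDp W 2`; and granted the Kato half the three statements Eisenstein half / main conjecture /
  `BSD(E,2)` are each EQUIVALENT to `MissingLowerBoundAt W 2` (`…_iff_missingLowerBoundAt_of_katoHalf`).
  Certificate forms: `μ(X) = 0` for the cyclotomic data (`eisensteinAtTwo_of_mu_eq_zero_of_missingLowerBoundAt`)
  or the tower-gap certificate `TowerGapAtTwo W` (`eisensteinAtTwo_of_towerGap_of_missingLowerBoundAt`) +
  Néron integrality + the descent inequality ⇒ the Eisenstein half at `W` — no `λ_an`, no `μ_an`.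

READING FOR THE ITEM. This sharpens the tree's `KatoHalfPinch` (Kato half + EXACT `BSD(E,2)` ⇒ MC): the
upper bound on `Ш` is Kato's theorem, so only the LOWER bound is consumed. On the formula route's domain
(rank `0`) the crux `OrdEisensteinHalfAtTwo` therefore carries, beyond its sibling `OrdKatoHalfAtTwo`,
exactly ONE descent inequality per curve — certificate-shaped (exhibit `2^{ord₂ #Ш_an}` elements of
`Ш[2^∞]`; on the `ord₂ #Ш_an = 4` classes: `Sel₂(E/ℚ) = Ш[2] ≅ (ℤ/2)²` with trivial Cassels–Tate
pairing), not «transcendental». The rank-`≥ 1` part of the crux is untouched (see `…ShaCrux.lean`).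

References: K. Kato, Astérisque 295 (2004), Thm. 17.4; R. Greenberg, LNM 1716 (1999), Thm. 4.1, Prop.
5.14; C. Skinner, E. Urban, Invent. Math. 195 (2014), Conj. 3.6.8 (p odd); R. L. Miller, LMS J. Comput.
Math. 14 (2011), Def. 1.1; L. Washington, GTM 83, §13.2.
-/

set_option autoImplicit false

noncomputable section

open scoped Classical MatrixGroups ModularForm

open CongruenceSubgroup WeierstrassCurve Literature.NumberTheory.EllipticCurves
  Literature.NumberTheory.EllipticCurves.ModularForms Literature.NumberTheory.EllipticCurves.Rank1Residual
  Literature.NumberTheory.EllipticCurves.Rank1Residual.Typed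
  Summit.BirchSwinnertonDyer.Rank1Residual.X1.MuLambda
  Summit.BirchSwinnertonDyer.Rank1Residual.X1.MuPart
  Summit.BirchSwinnertonDyer.Rank1Residual.X1.ParitySqueeze

namespace Summit.BirchSwinnertonDyer.BirchSwinnertonDyer.Theorems.EisensteinShaCurrency

/-! ## §3 (continued) The Eisenstein clause and the main conjecture at a datum, in `Ш`-currency -/

section Datum

open Literature.NumberTheory.EllipticCurves.Wuthrich2014
  Summit.BirchSwinnertonDyer.Rank1Residual Summit.BirchSwinnertonDyer.Rank1Residual.X5

variable (W : WeierstrassCurve ℚ) [W.IsElliptic] [W.IsGloballyMinimal]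

/-- **(B) THE EISENSTEIN HALF AT A DATUM IN `Ш`-CURRENCY (slack form).** Same PUB inputs; `D` a
cyclotomic datum with generator `f_X`, `ι L₀ = 2ʲ·ϖ·L₂(f,α)` (`L₀ ≠ 0`). Then the item's clause
`∃ h ∈ Λ, ι f_X = ι h · ϖ·L₂(f,α)` holds IFF `μ(L₀) ≤ μ(X) + j` AND
`ord₂ #Ш_an + j + μ(X) ≤ ord₂ #Ш + μ(L₀)` — NO `λ`-invariant anywhere: the «transcendental»
inequality `λ_an ≤ λ(X)` of the tree's `eisensteinAtDatum_iff_lam_le_and_mu_le_slack` is EXACTLY an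
inequality between `#Ш(E)[2^∞]`, `#Ш_an(E)` and the two `μ`-invariants (by (A) it is an equality).
[cite: Kato2004Asterisque, Thm. 17.4 (1)(2) (p. 273)] [cite: GreenbergLNM1716, Thm. 4.1 (p. 102)]
[cite: SkinnerUrban2014, Conj. 3.6.8 (p. 45) (shape of the Eisenstein inclusion; p odd in print)] -/
theorem eisensteinAtDatum_iff_sha_slack {N : ℕ} [NeZero N] {f : CuspForm (Gamma0 N) 2}
    (h17 : kato_divisibility_allPrimes W 2 (f := f))
    (hEC : O1.TwoAdicEulerCharRankZero W 0) (hGZK : rank_eq_analyticRank_of_analyticRank_le_one)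
    (hord : IsOrdinaryAt W 2) (hL : W.entireLFunction 1 ≠ 0)
    {κ : ZpExtension ℚ 2} {γ : Field.absoluteGaloisGroup ℚ} (hκ : κ.IsCyclotomic)
    (hγ : κ.IsTopGenerator γ) (hγ' : IsCyclotomicVariable 2 γ) (hf : IsNewformOf W f)
    (D : W.SelmerDualData κ γ) {ϖ : ℚ} (hϖ : (ϖ : ℝ) * W.realPeriodRat = plusPeriod f)
    {fX : IwasawaAlgebra 2} (hchar : D.charIdeal = Ideal.span {fX}) {j : ℕ} {L₀ : IwasawaAlgebra 2}
    (hL₀0 : L₀ ≠ 0)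
    (hL₀ : iwasawaToPowerSeries 2 L₀ =
      PowerSeries.C (((2 : ℚ) ^ j * ϖ : ℚ) : ℚ_[2]) * padicLFunction f (unitRoot W 2 : ℚ_[2])) :
    (∃ h : IwasawaAlgebra 2, iwasawaToPowerSeries 2 fX =
        iwasawaToPowerSeries 2 h * (PowerSeries.C (ϖ : ℚ_[2]) * padicLFunction f (unitRoot W 2 : ℚ_[2])))
      ↔ mu L₀ ≤ D.mu + j ∧ ∃ q : ℚ, shaAn W = (q : ℂ) ∧
          padicValRat 2 q + j + D.mu ≤ (padicValNat 2 W.shaOrder : ℤ) + mu L₀ := by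
  have hϖ0 : ϖ ≠ 0 := X2.varpi_ne_zero_of_isNewformOf hf hϖ
  have hϖ'0 : (2 : ℚ) ^ j * ϖ ≠ 0 := mul_ne_zero (pow_ne_zero j two_ne_zero) hϖ0
  have hvϖ' : padicValRat 2 ((2 : ℚ) ^ j * ϖ) = j + padicValRat 2 ϖ := by
    have h2 : padicValRat 2 (2 : ℚ) = 1 := by exact_mod_cast padicValRat.self (p := 2) one_lt_two
    rw [padicValRat.mul (pow_ne_zero j two_ne_zero) hϖ0, padicValRat.pow, h2, mul_one]
  obtain ⟨q, hq, -, h2, -⟩ :=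
    sha_readings_of_kato W h17 hEC hGZK hord hL hκ hγ hγ' hf D hϖ hϖ'0 hchar hL₀
  rw [EisensteinLowerBounds.eisensteinAtDatum_iff_lam_le_and_mu_le_slack W h17 hκ hγ hγ' hord hf D
    hchar hL₀0 hL₀, h2, hvϖ']
  constructor
  · rintro ⟨hl, hm⟩
    exact ⟨hm, q, hq, by linarith⟩
  · rintro ⟨hm, q', hq', hl⟩
    have hqq : q' = q := by exact_mod_cast hq'.symm.trans hq
    subst hqq
    exact ⟨by linarith, hm⟩

/-- **(B₀) Néron-integral form (`j = 0`).** With `ι L₀ = ϖ·L₂(f,α)`: the Eisenstein clause at the datum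
holds IFF `μ(L₀) ≤ μ(X)` AND `ord₂ #Ш_an + μ(X) ≤ ord₂ #Ш + μ(L₀)`; with (A): iff `μ(L₀) ≤ μ(X)` and
`ord₂ #Ш = ord₂ #Ш_an + (μ(X) − μ(L₀))` — «the whole `Ш`-excess over the BSD prediction is `μ`».
[cite: Kato2004Asterisque, Thm. 17.4 (1)(2) (p. 273)] [cite: GreenbergLNM1716, Thm. 4.1 (p. 102)]
[cite: SkinnerUrban2014, Conj. 3.6.8 (p. 45) (shape; p odd in print)] -/
theorem eisensteinAtDatum_iff_sha {N : ℕ} [NeZero N] {f : CuspForm (Gamma0 N) 2}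
    (h17 : kato_divisibility_allPrimes W 2 (f := f))
    (hEC : O1.TwoAdicEulerCharRankZero W 0) (hGZK : rank_eq_analyticRank_of_analyticRank_le_one)
    (hord : IsOrdinaryAt W 2) (hL : W.entireLFunction 1 ≠ 0)
    {κ : ZpExtension ℚ 2} {γ : Field.absoluteGaloisGroup ℚ} (hκ : κ.IsCyclotomic)
    (hγ : κ.IsTopGenerator γ) (hγ' : IsCyclotomicVariable 2 γ) (hf : IsNewformOf W f)
    (D : W.SelmerDualData κ γ) {ϖ : ℚ} (hϖ : (ϖ : ℝ) * W.realPeriodRat = plusPeriod f)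
    {fX : IwasawaAlgebra 2} (hchar : D.charIdeal = Ideal.span {fX}) {L₀ : IwasawaAlgebra 2}
    (hL₀ : iwasawaToPowerSeries 2 L₀ =
      PowerSeries.C (ϖ : ℚ_[2]) * padicLFunction f (unitRoot W 2 : ℚ_[2])) :
    (∃ h : IwasawaAlgebra 2, iwasawaToPowerSeries 2 fX =
        iwasawaToPowerSeries 2 h * (PowerSeries.C (ϖ : ℚ_[2]) * padicLFunction f (unitRoot W 2 : ℚ_[2])))
      ↔ mu L₀ ≤ D.mu ∧ ∃ q : ℚ, shaAn W = (q : ℂ) ∧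
          padicValRat 2 q + D.mu ≤ (padicValNat 2 W.shaOrder : ℤ) + mu L₀ := by
  have hL₀' : iwasawaToPowerSeries 2 L₀ =
      PowerSeries.C (((2 : ℚ) ^ 0 * ϖ : ℚ) : ℚ_[2]) * padicLFunction f (unitRoot W 2 : ℚ_[2]) := by
    rw [hL₀, pow_zero, one_mul]
  have hL₀0 : L₀ ≠ 0 := ne_zero_of_iwasawaToPowerSeries_eq W hord hf
    (X2.varpi_ne_zero_of_isNewformOf hf hϖ) hL₀
  rw [eisensteinAtDatum_iff_sha_slack W h17 hEC hGZK hord hL hκ hγ hγ' hf D hϖ hchar hL₀0 hL₀']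
  simp only [Nat.cast_zero, add_zero]

/-- **(C) The `2`-adic MAIN CONJECTURE at a datum in `Ш`-currency.** Same PUB inputs, Néron-integral
`L₀`: `char_Λ X = (L₀)` IFF `μ(X) ≤ μ(L₀)` (the `μ`-inequality of the Kato–Néron half) AND
`ord₂ #Ш_an ≤ ord₂ #Ш` (`MissingLowerBoundAt W 2`, the LOWER bound on `Ш`). No `λ`, no exact `#Ш`:
(⇐) (A) and the two inequalities force `μ(X) = μ(L₀)` and `ord₂ f_X(0) = ord₂ L₀(0)`, reading (ii)
gives `λ(L₀) ≤ λ(X)`, and the tree's `exists_unit_charGen_eq_of_kato` gives `f_X = u·L₀`.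
[cite: Kato2004Asterisque, Thm. 17.4 (1)(2) (p. 273)] [cite: GreenbergLNM1716, Thm. 4.1 (p. 102)]
[cite: GreenbergVatsal2000, p. 4 (after Thm. (1.2))] -/
theorem charIdeal_eq_span_iff_mu_le_and_missingLowerBoundAt {N : ℕ} [NeZero N]
    {f : CuspForm (Gamma0 N) 2} (h17 : kato_divisibility_allPrimes W 2 (f := f))
    (hEC : O1.TwoAdicEulerCharRankZero W 0) (hGZK : rank_eq_analyticRank_of_analyticRank_le_one)
    (hord : IsOrdinaryAt W 2) (hL : W.entireLFunction 1 ≠ 0)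
    {κ : ZpExtension ℚ 2} {γ : Field.absoluteGaloisGroup ℚ} (hκ : κ.IsCyclotomic)
    (hγ : κ.IsTopGenerator γ) (hγ' : IsCyclotomicVariable 2 γ) (hf : IsNewformOf W f)
    (D : W.SelmerDualData κ γ) {ϖ : ℚ} (hϖ : (ϖ : ℝ) * W.realPeriodRat = plusPeriod f)
    {L₀ : IwasawaAlgebra 2}
    (hL₀ : iwasawaToPowerSeries 2 L₀ =
      PowerSeries.C (ϖ : ℚ_[2]) * padicLFunction f (unitRoot W 2 : ℚ_[2])) :
    D.charIdeal = Ideal.span {L₀} ↔ D.mu ≤ mu L₀ ∧ MissingLowerBoundAt W 2 := by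
  haveI : Module.Finite (IwasawaAlgebra 2) D.X := D.module_finite_holds hγ
  have hϖ0 : ϖ ≠ 0 := X2.varpi_ne_zero_of_isNewformOf hf hϖ
  have hL₀0 : L₀ ≠ 0 := ne_zero_of_iwasawaToPowerSeries_eq W hord hf hϖ0 hL₀
  have hD : D.IsTorsion := (h17 κ γ hκ hγ hγ' hord hf D).1
  constructor
  · intro hMC
    have hμeq : mu L₀ = D.mu := mu_generator_eq_muInvariant D.X hD hL₀0 hMC
    have hlameq : lam L₀ = D.lambda := lam_generator_eq_lambdaInvariant D.X hD hL₀0 hMC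
    obtain ⟨q, hq, -, h2, -⟩ :=
      sha_readings_of_kato W h17 hEC hGZK hord hL hκ hγ hγ' hf D hϖ hϖ0 hMC hL₀
    have hineq := h2.mp hlameq.le
    have hμZ : (mu L₀ : ℤ) = D.mu := by exact_mod_cast hμeq
    refine ⟨hμeq.ge, q, hq, by linarith⟩
  · rintro ⟨hμ, q', hq', hlow⟩
    obtain ⟨fX, hfX⟩ := (charIdeal_isPrincipal_holds 2 D.X).principal
    have hchar : D.charIdeal = Ideal.span {fX} := hfX
    obtain ⟨q, hq, h1, h2, -⟩ :=
      sha_readings_of_kato W h17 hEC hGZK hord hL hκ hγ hγ' hf D hϖ hϖ0 hchar hL₀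
    have hqq : q' = q := by exact_mod_cast hq'.symm.trans hq
    subst hqq
    have hμ' : (D.mu : ℤ) ≤ mu L₀ := by exact_mod_cast hμ
    have hμeq : D.mu = mu L₀ := by
      have : (mu L₀ : ℤ) ≤ D.mu := by linarith
      exact le_antisymm hμ (by exact_mod_cast this)
    have hμZ : (D.mu : ℤ) = mu L₀ := by exact_mod_cast hμeq
    have hlam : lam L₀ ≤ D.lambda := h2.mpr (by linarith)
    obtain ⟨u, hu⟩ := EisensteinLowerBounds.exists_unit_charGen_eq_of_kato W h17 hκ hγ hγ' hord hf D
      hchar hL₀0 hL₀ hlam hμeq.ge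
    rw [hchar, hu, hμeq, Nat.sub_self, pow_zero, map_one, one_mul]
    exact Ideal.span_singleton_eq_span_singleton.mpr (associated_unit_mul_left _ _ u.isUnit)

/-- **(C′) With a `μ`-MATCH the main conjecture at the datum IS the lower bound on `Ш`.** Same PUB
inputs, Néron-integral `L₀`, and `μ(X) = μ(L₀)` (e.g. both `0`: tower-gap / Prop-5.14 certificate +
`μ_an = 0` engine certificate): `char_Λ X = (L₀) ⟺ MissingLowerBoundAt W 2`.
[cite: Kato2004Asterisque, Thm. 17.4 (1)(2) (p. 273)] [cite: GreenbergLNM1716, Thm. 4.1 (p. 102)] -/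
theorem charIdeal_eq_span_iff_missingLowerBoundAt_of_mu_eq {N : ℕ} [NeZero N]
    {f : CuspForm (Gamma0 N) 2} (h17 : kato_divisibility_allPrimes W 2 (f := f))
    (hEC : O1.TwoAdicEulerCharRankZero W 0) (hGZK : rank_eq_analyticRank_of_analyticRank_le_one)
    (hord : IsOrdinaryAt W 2) (hL : W.entireLFunction 1 ≠ 0)
    {κ : ZpExtension ℚ 2} {γ : Field.absoluteGaloisGroup ℚ} (hκ : κ.IsCyclotomic)
    (hγ : κ.IsTopGenerator γ) (hγ' : IsCyclotomicVariable 2 γ) (hf : IsNewformOf W f)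
    (D : W.SelmerDualData κ γ) {ϖ : ℚ} (hϖ : (ϖ : ℝ) * W.realPeriodRat = plusPeriod f)
    {L₀ : IwasawaAlgebra 2}
    (hL₀ : iwasawaToPowerSeries 2 L₀ =
      PowerSeries.C (ϖ : ℚ_[2]) * padicLFunction f (unitRoot W 2 : ℚ_[2])) (hμ : D.mu = mu L₀) :
    D.charIdeal = Ideal.span {L₀} ↔ MissingLowerBoundAt W 2 := by
  rw [charIdeal_eq_span_iff_mu_le_and_missingLowerBoundAt W h17 hEC hGZK hord hL hκ hγ hγ' hf D hϖ hL₀,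
    hμ]
  exact ⟨fun h => h.2, fun h => ⟨le_rfl, h⟩⟩

/-- **(B′) With a `μ`-MATCH the EISENSTEIN clause at the datum IS the lower bound on `Ш`.**
[cite: Kato2004Asterisque, Thm. 17.4 (1)(2) (p. 273)] [cite: GreenbergLNM1716, Thm. 4.1 (p. 102)]
[cite: SkinnerUrban2014, Conj. 3.6.8 (p. 45) (shape; p odd in print)] -/
theorem eisensteinAtDatum_iff_missingLowerBoundAt_of_mu_eq {N : ℕ} [NeZero N]
    {f : CuspForm (Gamma0 N) 2} (h17 : kato_divisibility_allPrimes W 2 (f := f))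
    (hEC : O1.TwoAdicEulerCharRankZero W 0) (hGZK : rank_eq_analyticRank_of_analyticRank_le_one)
    (hord : IsOrdinaryAt W 2) (hL : W.entireLFunction 1 ≠ 0)
    {κ : ZpExtension ℚ 2} {γ : Field.absoluteGaloisGroup ℚ} (hκ : κ.IsCyclotomic)
    (hγ : κ.IsTopGenerator γ) (hγ' : IsCyclotomicVariable 2 γ) (hf : IsNewformOf W f)
    (D : W.SelmerDualData κ γ) {ϖ : ℚ} (hϖ : (ϖ : ℝ) * W.realPeriodRat = plusPeriod f)
    {fX : IwasawaAlgebra 2} (hchar : D.charIdeal = Ideal.span {fX}) {L₀ : IwasawaAlgebra 2}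
    (hL₀ : iwasawaToPowerSeries 2 L₀ =
      PowerSeries.C (ϖ : ℚ_[2]) * padicLFunction f (unitRoot W 2 : ℚ_[2])) (hμ : D.mu = mu L₀) :
    (∃ h : IwasawaAlgebra 2, iwasawaToPowerSeries 2 fX =
        iwasawaToPowerSeries 2 h * (PowerSeries.C (ϖ : ℚ_[2]) * padicLFunction f (unitRoot W 2 : ℚ_[2])))
      ↔ MissingLowerBoundAt W 2 := by
  rw [eisensteinAtDatum_iff_sha W h17 hEC hGZK hord hL hκ hγ hγ' hf D hϖ hchar hL₀, hμ]
  constructor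
  · rintro ⟨-, q, hq, hle⟩; exact ⟨q, hq, by linarith⟩
  · rintro ⟨q, hq, hle⟩; exact ⟨le_rfl, q, hq, by linarith⟩

end Datum

/-! ## §4 Per curve: the Eisenstein half, the main conjecture and `BSD(E,2)` from the Kato half + the LOWER bound on `Ш` -/

section Curve

open Literature.NumberTheory.EllipticCurves.Wuthrich2014
  Summit.BirchSwinnertonDyer.Rank1Residual Summit.BirchSwinnertonDyer.Rank1Residual.X5
  Summit.BirchSwinnertonDyer.BirchSwinnertonDyer.Theorems.Rank1ResidualX1Defs

variable (W : WeierstrassCurve ℚ) [W.IsElliptic] [W.IsGloballyMinimal]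

/-- **The `2`-adic main conjecture on a rank-`0` good-ordinary-at-`2` curve from the KATO HALF and the
LOWER bound on `Ш`.** PUBLISHED inputs as hypotheses: Kato 17.4 (1)(2) AT `2` (`h17`), Greenberg 4.1
AT `2` (`hEC`), GZK (`hGZK`), modularity (`hmod`, for `L(E,1) ≠ 0` at analytic rank `0`); plus the
Kato–Néron half `X5.O1.MainConjectureLowerDivisibilityAtTwoOrd W` (crux `OrdKatoHalfAtTwo` at `W`;
on the `μ = 0` locus a theorem, `KatoOrdTwoMuPart`) and `MissingLowerBoundAt W 2`
(`ord₂ #Ш_an ≤ ord₂ #Ш` — ONE-SIDED, descent-shaped). Sharpens the tree's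
`KatoHalfPinch.mazurMainConjecture_two_of_katoHalfAt_of_bsdp` (which consumes the EXACT `BSD(E,2)`):
the upper bound on `Ш` is not an input, it is Kato's theorem. No `λ`, no `hper₀`, no Prop-5.14 point.
[cite: Kato2004Asterisque, Thm. 17.4 (1)(2) (p. 273)] [cite: GreenbergLNM1716, Thm. 4.1 (p. 102)]
[cite: CastellaGrossiSkinner2025, Introduction (MC) (shape of the conclusion)] -/
theorem mazurMainConjecture_two_of_katoHalf_of_missingLowerBoundAt
    (h17 : ∀ [NeZero (W.conductorNorm ℤ)] (f : CuspForm (Gamma0 (W.conductorNorm ℤ)) 2),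
      kato_divisibility_allPrimes W 2 (f := f))
    (hEC : O1.TwoAdicEulerCharRankZero W 0) (hGZK : rank_eq_analyticRank_of_analyticRank_le_one)
    (hmod : nonempty_modularParametrizationData) (hgo : GoodOrd W 2) (hr : W.analyticRank = 0)
    (hK : O1.MainConjectureLowerDivisibilityAtTwoOrd W) (hsha : MissingLowerBoundAt W 2) :
    MazurMainConjecture W 2 := by
  intro κ γ hκ hγ hγ' _ f hf ϖ hϖ D
  have hord : IsOrdinaryAt W 2 := hgo
  haveI : Module.Finite (IwasawaAlgebra 2) D.X := D.module_finite_holds hγ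
  have hL : W.entireLFunction 1 ≠ 0 := entireLFunction_one_ne_zero_of_analyticRank_eq_zero hmod W hr
  obtain ⟨L₀, hmem, hL₀⟩ := hK κ γ hκ hγ hγ' hord f hf ϖ hϖ D
  have hD : D.IsTorsion := (h17 f κ γ hκ hγ hγ' hord hf D).1
  have hL₀0 : L₀ ≠ 0 := ne_zero_of_iwasawaToPowerSeries_eq W hord hf
    (X2.varpi_ne_zero_of_isNewformOf hf hϖ) hL₀
  -- `μ(X) ≤ μ(L₀)`: `L₀ ∈ char X = (f_X)`, so `f_X ∣ L₀`
  obtain ⟨fX, hfX⟩ := (charIdeal_isPrincipal_holds 2 D.X).principal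
  have hchar : D.charIdeal = Ideal.span {fX} := hfX
  rw [hchar] at hmem
  obtain ⟨c, hc⟩ := Ideal.mem_span_singleton'.mp hmem
  have hfX0 : fX ≠ 0 := by rintro rfl; exact hL₀0 (by rw [← hc, mul_zero])
  have hc0 : c ≠ 0 := by rintro rfl; exact hL₀0 (by rw [← hc, zero_mul])
  have hμfX : mu fX = D.mu := mu_generator_eq_muInvariant D.X hD hfX0 hchar
  have hμle' : mu fX ≤ mu L₀ := by
    rw [← hc, mul_comm]
    exact mu_le_mu_mul hfX0 hc0
  have hμle : D.mu ≤ mu L₀ := hμfX ▸ hμle'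
  exact ⟨hD, L₀, (charIdeal_eq_span_iff_mu_le_and_missingLowerBoundAt W (h17 f) hEC hGZK hord hL hκ
    hγ hγ' hf D hϖ hL₀).mpr ⟨hμle, hsha⟩, hL₀⟩

/-- **The EISENSTEIN half at `2` from the Kato half + the LOWER bound on `Ш`** (rank-`0`
good-ordinary curve, PUB as hypotheses): via the main conjecture and the landed bookkeeping
`X5.O1.mainConjectureEisensteinDivisibilityAtTwo_of_mazurMainConjecture`. This is the certificate
door of the crux `OrdEisensteinHalfAtTwo` at `W` on the formula route's domain: its two inputs beyond
PRINT are the sibling crux at `W` and ONE descent inequality.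
[cite: Kato2004Asterisque, Thm. 17.4 (1)(2) (p. 273)] [cite: GreenbergLNM1716, Thm. 4.1 (p. 102)]
[cite: SkinnerUrban2014, Conj. 3.6.8 (p. 45) (shape; p odd in print)] -/
theorem eisensteinAtTwo_of_katoHalf_of_missingLowerBoundAt
    (h17 : ∀ [NeZero (W.conductorNorm ℤ)] (f : CuspForm (Gamma0 (W.conductorNorm ℤ)) 2),
      kato_divisibility_allPrimes W 2 (f := f))
    (hEC : O1.TwoAdicEulerCharRankZero W 0) (hGZK : rank_eq_analyticRank_of_analyticRank_le_one)
    (hmod : nonempty_modularParametrizationData) (hgo : GoodOrd W 2) (hr : W.analyticRank = 0)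
    (hK : O1.MainConjectureLowerDivisibilityAtTwoOrd W) (hsha : MissingLowerBoundAt W 2) :
    O1.MainConjectureEisensteinDivisibilityAtTwo W :=
  O1.mainConjectureEisensteinDivisibilityAtTwo_of_mazurMainConjecture W fun _ =>
    mazurMainConjecture_two_of_katoHalf_of_missingLowerBoundAt W h17 hEC hGZK hmod hgo hr hK hsha

/-- **`BSD(E,2)` from the Kato half + the LOWER bound on `Ш`** (rank-`0` good-ordinary curve, PUB as
hypotheses): the Kato half gives the upper bound (tree theorem
`missingUpperBoundAt_two_of_mainConjectureLowerDivisibilityAtTwoOrd_of_kato`), the two halves of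
Miller's currency make `MissingPPartAt`, and GZK closes `BSDp`. Bookkeeping.
[cite: Miller2011LMS, Def. 1.1] [cite: Kato2004Asterisque, Thm. 17.4 (1)(2) (p. 273)] -/
theorem bsdp_two_of_katoHalf_of_missingLowerBoundAt
    (h17 : ∀ [NeZero (W.conductorNorm ℤ)] (f : CuspForm (Gamma0 (W.conductorNorm ℤ)) 2),
      kato_divisibility_allPrimes W 2 (f := f))
    (hEC : O1.TwoAdicEulerCharRankZero W 0) (hGZK : rank_eq_analyticRank_of_analyticRank_le_one)
    (hmod : nonempty_modularParametrizationData) (hgo : GoodOrd W 2) (hr : W.analyticRank = 0)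
    (hK : O1.MainConjectureLowerDivisibilityAtTwoOrd W) (hsha : MissingLowerBoundAt W 2) :
    BSDp W 2 :=
  bsdp_of_missingPPartAt W 2 hGZK (by rw [hr]; exact zero_le_one)
    (missingPPartAt_of_lower_of_upper W 2 hsha
      (O1.missingUpperBoundAt_two_of_mainConjectureLowerDivisibilityAtTwoOrd_of_kato W hEC hmod hGZK h17
        hr hgo hK))

/-- **Granted the Kato half at a rank-`0` good-ordinary curve, the EISENSTEIN half IS the lower bound
on `Ш`.** (⇒) is the tree's `missingLowerBoundAt_two_of_eisenstein_of_kato` (no Kato half needed);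
(⇐) is `eisensteinAtTwo_of_katoHalf_of_missingLowerBoundAt`.
[cite: Kato2004Asterisque, Thm. 17.4 (1)(2) (p. 273)] [cite: GreenbergLNM1716, Thm. 4.1 (p. 102)] -/
theorem eisensteinAtTwo_iff_missingLowerBoundAt_of_katoHalf
    (h17 : ∀ [NeZero (W.conductorNorm ℤ)] (f : CuspForm (Gamma0 (W.conductorNorm ℤ)) 2),
      kato_divisibility_allPrimes W 2 (f := f))
    (hEC : O1.TwoAdicEulerCharRankZero W 0) (hGZK : rank_eq_analyticRank_of_analyticRank_le_one)
    (hmod : nonempty_modularParametrizationData) (hgo : GoodOrd W 2) (hr : W.analyticRank = 0)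
    (hK : O1.MainConjectureLowerDivisibilityAtTwoOrd W) :
    O1.MainConjectureEisensteinDivisibilityAtTwo W ↔ MissingLowerBoundAt W 2 :=
  ⟨O1.missingLowerBoundAt_two_of_eisenstein_of_kato W hEC hmod hGZK h17 hr hgo,
    eisensteinAtTwo_of_katoHalf_of_missingLowerBoundAt W h17 hEC hGZK hmod hgo hr hK⟩

/-- **Granted the Kato half, the `2`-adic main conjecture IS the lower bound on `Ш`.**
[cite: Kato2004Asterisque, Thm. 17.4 (1)(2) (p. 273)] [cite: GreenbergLNM1716, Thm. 4.1 (p. 102)] -/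
theorem mazurMainConjecture_two_iff_missingLowerBoundAt_of_katoHalf
    (h17 : ∀ [NeZero (W.conductorNorm ℤ)] (f : CuspForm (Gamma0 (W.conductorNorm ℤ)) 2),
      kato_divisibility_allPrimes W 2 (f := f))
    (hEC : O1.TwoAdicEulerCharRankZero W 0) (hGZK : rank_eq_analyticRank_of_analyticRank_le_one)
    (hmod : nonempty_modularParametrizationData) (hgo : GoodOrd W 2) (hr : W.analyticRank = 0)
    (hK : O1.MainConjectureLowerDivisibilityAtTwoOrd W) :
    MazurMainConjecture W 2 ↔ MissingLowerBoundAt W 2 :=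
  ⟨fun h => O1.missingLowerBoundAt_two_of_eisenstein_of_kato W hEC hmod hGZK h17 hr hgo
      (O1.mainConjectureEisensteinDivisibilityAtTwo_of_mazurMainConjecture W fun _ => h),
    mazurMainConjecture_two_of_katoHalf_of_missingLowerBoundAt W h17 hEC hGZK hmod hgo hr hK⟩

/-- **Granted the Kato half, `BSD(E,2)` IS the lower bound on `Ш`** (the upper bound being Kato's).
[cite: Miller2011LMS, Def. 1.1] [cite: Kato2004Asterisque, Thm. 17.4 (1)(2) (p. 273)] -/
theorem bsdp_two_iff_missingLowerBoundAt_of_katoHalf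
    (h17 : ∀ [NeZero (W.conductorNorm ℤ)] (f : CuspForm (Gamma0 (W.conductorNorm ℤ)) 2),
      kato_divisibility_allPrimes W 2 (f := f))
    (hEC : O1.TwoAdicEulerCharRankZero W 0) (hGZK : rank_eq_analyticRank_of_analyticRank_le_one)
    (hmod : nonempty_modularParametrizationData) (hgo : GoodOrd W 2) (hr : W.analyticRank = 0)
    (hK : O1.MainConjectureLowerDivisibilityAtTwoOrd W) :
    BSDp W 2 ↔ MissingLowerBoundAt W 2 := by
  refine ⟨fun h => ?_, bsdp_two_of_katoHalf_of_missingLowerBoundAt W h17 hEC hGZK hmod hgo hr hK⟩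
  haveI : Finite W.sha := (hGZK W (by rw [hr]; exact zero_le_one)).2
  exact (lower_and_upper_of_missingPPartAt W 2 (missingPPartAt_of_bsdp W 2 h)).1

/-- **Certificate form on the `μ = 0` locus.** Rank-`0` good-ordinary curve, PUB as hypotheses, the
Néron-integrality certificate `hper₀` (`0 ≤ ord₂ ϖ`), `μ(X(E/ℚ_∞)) = 0` for every cyclotomic datum
(`hμ`: Greenberg Prop. 5.14 on the α-go habitat, or the tower-gap certificate `TowerGapAtTwo W`
elsewhere — NOT asserted) and the descent inequality `MissingLowerBoundAt W 2` ⇒ the Eisenstein half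
at `W`. (`μ = 0` gives the Kato half: `katoMuPartAtTwo_of_mu_eq_zero` +
`mainConjectureLowerDivisibilityAtTwoOrd_of_katoMuPartAtTwo`.) No `λ_an`, no `μ_an` certificate.
[cite: Kato2004Asterisque, Thm. 17.4 (1)(2) (p. 273)] [cite: GreenbergLNM1716, Thm. 4.1 (p. 102) and Prop. 5.14 (p. 121)] -/
theorem eisensteinAtTwo_of_mu_eq_zero_of_missingLowerBoundAt
    (h17 : ∀ [NeZero (W.conductorNorm ℤ)] (f : CuspForm (Gamma0 (W.conductorNorm ℤ)) 2),
      kato_divisibility_allPrimes W 2 (f := f))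
    (hper₀ : ∀ [NeZero (W.conductorNorm ℤ)] (f : CuspForm (Gamma0 (W.conductorNorm ℤ)) 2),
      IsNewformOf W f → ∀ ϖ : ℚ, (ϖ : ℝ) * W.realPeriodRat = plusPeriod f → 0 ≤ padicValRat 2 ϖ)
    (hEC : O1.TwoAdicEulerCharRankZero W 0) (hGZK : rank_eq_analyticRank_of_analyticRank_le_one)
    (hmod : nonempty_modularParametrizationData) (hgo : GoodOrd W 2) (hr : W.analyticRank = 0)
    (hμ : ∀ (κ : ZpExtension ℚ 2) (γ : Field.absoluteGaloisGroup ℚ), κ.IsCyclotomic →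
      κ.IsTopGenerator γ → IsCyclotomicVariable 2 γ → ∀ D : W.SelmerDualData κ γ, D.mu = 0)
    (hsha : MissingLowerBoundAt W 2) :
    O1.MainConjectureEisensteinDivisibilityAtTwo W :=
  have hord : IsOrdinaryAt W 2 := hgo
  eisensteinAtTwo_of_katoHalf_of_missingLowerBoundAt W h17 hEC hGZK hmod hgo hr
    (O1.mainConjectureLowerDivisibilityAtTwoOrd_of_katoMuPartAtTwo W h17
      (fun f hf ϖ hϖ => O1.exists_integral_mul_padicLFunction_two_of_padicValRat_nonneg W hord hf
        (hper₀ f hf ϖ hϖ))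
      (O1.katoMuPartAtTwo_of_mu_eq_zero W hμ)) hsha

/-- **Tower-gap form**: the same with `TowerGapAtTwo W` (⟺ `X` torsion ∧ `μ₂ = 0` for the cyclotomic
data, `towerGapAtTwo_iff_isTorsion_and_mu_eq_zero`) as the `μ`-certificate — the currency of the
sibling seats' tower programme for `OrdKatoHalfAtTwo`. [cite: Washington1997, §13.2]
[cite: Kato2004Asterisque, Thm. 17.4 (1)(2) (p. 273)] [cite: GreenbergLNM1716, Thm. 4.1 (p. 102)] -/
theorem eisensteinAtTwo_of_towerGap_of_missingLowerBoundAt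
    (h17 : ∀ [NeZero (W.conductorNorm ℤ)] (f : CuspForm (Gamma0 (W.conductorNorm ℤ)) 2),
      kato_divisibility_allPrimes W 2 (f := f))
    (hper₀ : ∀ [NeZero (W.conductorNorm ℤ)] (f : CuspForm (Gamma0 (W.conductorNorm ℤ)) 2),
      IsNewformOf W f → ∀ ϖ : ℚ, (ϖ : ℝ) * W.realPeriodRat = plusPeriod f → 0 ≤ padicValRat 2 ϖ)
    (hEC : O1.TwoAdicEulerCharRankZero W 0) (hGZK : rank_eq_analyticRank_of_analyticRank_le_one)
    (hmod : nonempty_modularParametrizationData) (hgo : GoodOrd W 2) (hr : W.analyticRank = 0)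
    (hgap : O1.TowerGapAtTwo W) (hsha : MissingLowerBoundAt W 2) :
    O1.MainConjectureEisensteinDivisibilityAtTwo W :=
  eisensteinAtTwo_of_mu_eq_zero_of_missingLowerBoundAt W h17 hper₀ hEC hGZK hmod hgo hr
    (fun _ _ hκ hγ hγ' D => (O1.isTorsion_and_mu_eq_zero_of_towerGapAtTwo W hgap hκ hγ hγ' D).2) hsha

end Curve

end Summit.BirchSwinnertonDyer.BirchSwinnertonDyer.Theorems.EisensteinShaCurrency

end
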